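import Summits.MatrixMultiplication.MatrixMultiplication.Theorems.AsymptoticRankCWSkewNoDegeneration

/-!
# No equal-format degeneration `ε^{⊠k} ⊵ T_cw,2^{⊠k}` for ODD `k` (stmt-MatrixMultiplication-18009)

Route `MatrixMultiplication/AsymptoticRankCW`, crux `BThesis` (stmt-MatrixMultiplication-0588), line
`Cruxes/BThesis/Lines/skew_anchor.lean`, stub `stub_skewDominatesCw` = item `BSkewDominatesCw` (stmt-18009).
The file `AsymptoticRankCWSkewNoDegeneration.lean` (k = 1) showed that the Levi-Civita tensor `ε` does
not degenerate to `T_cw,2` because every `x`-slice of anything in the orbit closure of `ε` is singular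
while `T_cw,2` has a non-singular slice. The same argument runs VERBATIM for every odd Kronecker power:

* every `x`-slice `S` of `ε^{⊠k}` satisfies `Sᵀ = (-1)^k • S` (`ε(a,c,b) = -ε(a,b,c)` coordinatewise),
  so for odd `k` it is a skew-symmetric matrix of ODD size `3^k` and `det S = 0`; this passes to
  restrictions (`det (B S Cᵀ) = det B · det S · det C`) and, by continuity, to the orbit closure;
* the slice of `T_cw,2^{⊠k}` at the product vector `x^{⊗k}`, `x = (1,1,0)`, is the entrywise product
  `∏ᵢ M(bᵢ,cᵢ)` of the slice `M = !![0,1,0; 1,1,0; 0,0,1]` of `T_cw,2` (`det M = -1`); it is invertible,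
  with inverse `∏ᵢ M⁻¹(bᵢ,cᵢ)` (`∏ᵢ ∑ⱼ = ∑ ∏`), hence has non-zero determinant.

Hence `¬ (ε^{⊠k} ≥ T_cw,2^{⊠k})` and `¬ (ε^{⊠k} ⊵ T_cw,2^{⊠k})` (orbit closure in the common format
`(Fin k → Fin 3)³`) for all odd `k`. (For even `k` the slice argument fails — `det₃ ≅ ε ⊠ ε` has
non-singular slices — and the no-go is by orbit dimension instead: item evidence `equal-format-nogo.md`.)
All sorry-free; standard axioms; no definitions.

References: M. Christandl, P. Vrana, J. Zuiddam, J. Amer. Math. Soc. 36 (2023), Rem. 1.2 (degeneration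
= orbit closure); A. Conner, F. Gesmundo, J. M. Landsberg, E. Ventura, comput. complexity 31 (2022), §2.2.
-/

set_option linter.dupNamespace false

noncomputable section

namespace Summit.MatrixMultiplication.MatrixMultiplication.Theorems

open scoped BigOperators
open Matrix
open Literature.Computability.AlgebraicComplexity

/-! ## Slices of `ε^{⊠k}` are `(-1)^k`-symmetric -/

section Skew

/-- `ε(a,c,b) = -ε(a,b,c)` for the inline Levi-Civita tensor. [folklore] -/
theorem leviCivitaInline_swap (a b c : Fin 3) :
    (fun a b c : Fin 3 => (if b = a + 1 ∧ c = a + 2 then (1 : ℂ) else 0) -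
        (if b = a + 2 ∧ c = a + 1 then 1 else 0)) a c b =
      -(fun a b c : Fin 3 => (if b = a + 1 ∧ c = a + 2 then (1 : ℂ) else 0) -
        (if b = a + 2 ∧ c = a + 1 then 1 else 0)) a b c := by
  fin_cases a <;> fin_cases b <;> fin_cases c <;> simp

/-- `ε^{⊠k}(a,c,b) = (-1)^k ε^{⊠k}(a,b,c)`. [folklore] -/
theorem kroneckerPow_leviCivitaInline_swap (k : ℕ) (a b c : Fin k → Fin 3) :
    kroneckerPow (fun a b c : Fin 3 => (if b = a + 1 ∧ c = a + 2 then (1 : ℂ) else 0) -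
        (if b = a + 2 ∧ c = a + 1 then 1 else 0)) k a c b =
      (-1) ^ k * kroneckerPow (fun a b c : Fin 3 => (if b = a + 1 ∧ c = a + 2 then (1 : ℂ) else 0) -
        (if b = a + 2 ∧ c = a + 1 then 1 else 0)) k a b c := by
  simp only [kroneckerPow_apply]
  rw [Finset.prod_congr rfl fun i _ => leviCivitaInline_swap (a i) (b i) (c i), Finset.prod_neg,
    Finset.card_univ, Fintype.card_fin]

/-- **Every `x`-slice of `ε^{⊠k}` satisfies `Sᵀ = (-1)^k • S`.** [folklore] -/
theorem transpose_sliceMatrix_kroneckerPow_leviCivitaInline (k : ℕ) (y : (Fin k → Fin 3) → ℂ) :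
    (Matrix.of fun (b c : Fin k → Fin 3) => ∑ a, y a *
      kroneckerPow (fun a b c : Fin 3 => (if b = a + 1 ∧ c = a + 2 then (1 : ℂ) else 0) -
        (if b = a + 2 ∧ c = a + 1 then 1 else 0)) k a b c)ᵀ =
    ((-1 : ℂ) ^ k) • (Matrix.of fun (b c : Fin k → Fin 3) => ∑ a, y a *
      kroneckerPow (fun a b c : Fin 3 => (if b = a + 1 ∧ c = a + 2 then (1 : ℂ) else 0) -
        (if b = a + 2 ∧ c = a + 1 then 1 else 0)) k a b c) := by
  ext b c
  simp only [Matrix.transpose_apply, Matrix.of_apply, Matrix.smul_apply, smul_eq_mul, Finset.mul_sum]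
  refine Finset.sum_congr rfl fun a _ => ?_
  rw [kroneckerPow_leviCivitaInline_swap]
  ring

/-- **For odd `k`, every `x`-slice of `ε^{⊠k}` is singular**: a skew-symmetric matrix of odd size
`3^k` has determinant `0` (`det S = det Sᵀ = det (-S) = (-1)^{3^k} det S = -det S`). [folklore] -/
theorem det_sliceMatrix_kroneckerPow_leviCivitaInline {k : ℕ} (hk : Odd k)
    (y : (Fin k → Fin 3) → ℂ) :
    (Matrix.of fun (b c : Fin k → Fin 3) => ∑ a, y a *
      kroneckerPow (fun a b c : Fin 3 => (if b = a + 1 ∧ c = a + 2 then (1 : ℂ) else 0) -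
        (if b = a + 2 ∧ c = a + 1 then 1 else 0)) k a b c).det = 0 := by
  set S := (Matrix.of fun (b c : Fin k → Fin 3) => ∑ a, y a *
      kroneckerPow (fun a b c : Fin 3 => (if b = a + 1 ∧ c = a + 2 then (1 : ℂ) else 0) -
        (if b = a + 2 ∧ c = a + 1 then 1 else 0)) k a b c) with hS
  have hT := transpose_sliceMatrix_kroneckerPow_leviCivitaInline k y
  rw [← hS] at hT
  have hodd : Odd (Fintype.card (Fin k → Fin 3)) := by
    rw [Fintype.card_fun, Fintype.card_fin, Fintype.card_fin]
    exact Odd.pow (by decide)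
  have h1 : S.det = -S.det := by
    calc S.det = Sᵀ.det := (Matrix.det_transpose S).symm
      _ = (((-1 : ℂ) ^ k) • S).det := by rw [hT]
      _ = ((-1 : ℂ) ^ k) ^ Fintype.card (Fin k → Fin 3) * S.det := Matrix.det_smul S _
      _ = -S.det := by rw [hk.neg_one_pow, hodd.neg_one_pow, neg_one_mul]
  linear_combination (1 / 2 : ℂ) * h1

end Skew

/-! ## Restrictions and degenerations of `ε^{⊠k}` have singular slices (odd `k`) -/

section Closure

/-- Slices of restrictions of `ε^{⊠k}` (odd `k`), in the format `(Fin k → Fin 3)³`, are singular.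
[folklore] -/
theorem det_sliceMatrix_eq_zero_of_kroneckerPow_leviCivita_restrictsTo {k : ℕ} (hk : Odd k)
    {s : (Fin k → Fin 3) → (Fin k → Fin 3) → (Fin k → Fin 3) → ℂ}
    (h : TensorRestrictsTo (kroneckerPow (fun a b c : Fin 3 =>
      (if b = a + 1 ∧ c = a + 2 then (1 : ℂ) else 0) - (if b = a + 2 ∧ c = a + 1 then 1 else 0)) k) s)
    (x : (Fin k → Fin 3) → ℂ) :
    (Matrix.of fun (b c : Fin k → Fin 3) => ∑ a, x a * s a b c).det = 0 := by
  obtain ⟨A, B, C, hs⟩ := (tensorRestrictsTo_iff_exists_actTensor _ _).1 h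
  subst hs
  rw [det_sliceMatrix_actTensor, det_sliceMatrix_kroneckerPow_leviCivitaInline hk, mul_zero, zero_mul]

/-- The slice-determinant at a fixed `x` is continuous in the tensor (any finite format). [folklore] -/
theorem continuous_det_sliceMatrix' {ι n : Type*} [Fintype ι] [Fintype n] [DecidableEq n]
    (x : ι → ℂ) :
    Continuous fun s : ι → n → n → ℂ => (Matrix.of fun (b c : n) => ∑ a, x a * s a b c).det := by
  refine Continuous.matrix_det ?_
  refine continuous_pi fun b => continuous_pi fun c => ?_
  simp only [Matrix.of_apply]
  refine continuous_finsetSum _ fun a _ => ?_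
  exact continuous_const.mul
    ((continuous_apply c).comp ((continuous_apply b).comp (continuous_apply a)))

/-- Slices of DEGENERATIONS of `ε^{⊠k}` (odd `k`; orbit closure in the format `(Fin k → Fin 3)³`)
are singular (CVZ Rem. 1.2: the orbit consists of restrictions, and the slice-determinant is
continuous). [cite: ChristandlVranaZuiddam2023, Rem. 1.2] -/
theorem det_sliceMatrix_eq_zero_of_kroneckerPow_leviCivita_degeneratesTo {k : ℕ} (hk : Odd k)
    {s : (Fin k → Fin 3) → (Fin k → Fin 3) → (Fin k → Fin 3) → ℂ}
    (h : TensorDegeneratesTo (kroneckerPow (fun a b c : Fin 3 =>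
      (if b = a + 1 ∧ c = a + 2 then (1 : ℂ) else 0) - (if b = a + 2 ∧ c = a + 1 then 1 else 0)) k) s)
    (x : (Fin k → Fin 3) → ℂ) :
    (Matrix.of fun (b c : Fin k → Fin 3) => ∑ a, x a * s a b c).det = 0 := by
  unfold TensorDegeneratesTo at h
  have hclosed : IsClosed {s : (Fin k → Fin 3) → (Fin k → Fin 3) → (Fin k → Fin 3) → ℂ |
      (Matrix.of fun (b c : Fin k → Fin 3) => ∑ a, x a * s a b c).det = 0} :=
    isClosed_eq (continuous_det_sliceMatrix' x) continuous_const
  refine closure_minimal ?_ hclosed h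
  rintro _ ⟨g, rfl⟩
  show (Matrix.of fun (b c : Fin k → Fin 3) => ∑ a, x a * actTensor _ _ _ _ a b c).det = 0
  rw [det_sliceMatrix_actTensor, det_sliceMatrix_kroneckerPow_leviCivitaInline hk, mul_zero, zero_mul]

end Closure

/-! ## `T_cw,2^{⊠k}` has a non-singular slice -/

section CwSlice

/-- The slice of `T_cw,2` at `x = (1,1,0)` and its inverse, as explicit matrices. [folklore] -/
theorem sliceMatrix_cwTensor_two_eq :
    (Matrix.of fun (b c : Fin 3) => ∑ a, (![1, 1, 0] : Fin 3 → ℂ) a * cwTensor ℂ 2 a b c) =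
      !![0, 1, 0; 1, 1, 0; 0, 0, 1] := by
  ext b c
  fin_cases b <;> fin_cases c <;> simp [Fin.sum_univ_three, cwTensor]

/-- `!![0,1,0; 1,1,0; 0,0,1] * !![-1,1,0; 1,0,0; 0,0,1] = 1`. [folklore] -/
theorem sliceMatrix_cwTensor_two_mul_inv :
    (!![0, 1, 0; 1, 1, 0; 0, 0, 1] : Matrix (Fin 3) (Fin 3) ℂ) * !![-1, 1, 0; 1, 0, 0; 0, 0, 1] = 1 := by
  ext i j
  fin_cases i <;> fin_cases j <;> simp [Matrix.mul_apply, Fin.sum_univ_three]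

/-- The slice of `T_cw,2^{⊠k}` at the product vector `x^{⊗k}` is the entrywise product of slices:
`∑ₐ (∏ᵢ x(aᵢ)) ∏ᵢ T(aᵢ,bᵢ,cᵢ) = ∏ᵢ ∑ⱼ x(j) T(j,bᵢ,cᵢ)`. [folklore] -/
theorem sliceMatrix_kroneckerPow_prodVec {k : ℕ} (t : Fin 3 → Fin 3 → Fin 3 → ℂ) (x : Fin 3 → ℂ)
    (b c : Fin k → Fin 3) :
    ∑ a : Fin k → Fin 3, (∏ i, x (a i)) * kroneckerPow t k a b c =
      ∏ i, (∑ j, x j * t j (b i) (c i)) := by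
  simp only [kroneckerPow_apply, ← Finset.prod_mul_distrib]
  rw [Finset.prod_univ_sum (fun _ => Finset.univ) (fun i j => x j * t j (b i) (c i))]
  simp [Fintype.piFinset_univ]

/-- Entrywise-product matrices multiply entrywise: `(∏ᵢ M(bᵢ,dᵢ)) · (∏ᵢ N(dᵢ,cᵢ))` summed over `d`
is `∏ᵢ (MN)(bᵢ,cᵢ)`. [folklore] -/
theorem piMatrix_mul {k : ℕ} (M N : Matrix (Fin 3) (Fin 3) ℂ) :
    (Matrix.of fun (b d : Fin k → Fin 3) => ∏ i, M (b i) (d i)) *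
        (Matrix.of fun (d c : Fin k → Fin 3) => ∏ i, N (d i) (c i)) =
      Matrix.of fun (b c : Fin k → Fin 3) => ∏ i, (M * N) (b i) (c i) := by
  ext b c
  simp only [Matrix.mul_apply, Matrix.of_apply, ← Finset.prod_mul_distrib]
  rw [Finset.prod_univ_sum (fun _ => Finset.univ) (fun i j => M (b i) j * N j (c i))]
  simp [Fintype.piFinset_univ]

/-- `∏ᵢ 1(bᵢ,cᵢ)` is the identity matrix on `Fin k → Fin 3`. [folklore] -/
theorem piMatrix_one {k : ℕ} :
    (Matrix.of fun (b c : Fin k → Fin 3) => ∏ i, (1 : Matrix (Fin 3) (Fin 3) ℂ) (b i) (c i)) = 1 := by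
  ext b c
  simp only [Matrix.of_apply, Matrix.one_apply]
  by_cases hbc : b = c
  · subst hbc
    simp
  · rw [if_neg hbc]
    obtain ⟨i, hi⟩ : ∃ i, b i ≠ c i := by
      by_contra hall
      push Not at hall
      exact hbc (funext hall)
    exact Finset.prod_eq_zero (Finset.mem_univ i) (if_neg hi)

/-- **`T_cw,2^{⊠k}` has a non-singular slice** (at `x^{⊗k}`, `x = (1,1,0)`): its slice is the
entrywise power of `M = !![0,1,0; 1,1,0; 0,0,1]`, with two-sided inverse the entrywise power of `M⁻¹`.
[folklore] -/
theorem det_sliceMatrix_kroneckerPow_cwTensor_two_ne_zero (k : ℕ) :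
    (Matrix.of fun (b c : Fin k → Fin 3) => ∑ a, (∏ i, (![1, 1, 0] : Fin 3 → ℂ) (a i)) *
      kroneckerPow (cwTensor ℂ 2) k a b c).det ≠ 0 := by
  have hM : ∀ b c : Fin k → Fin 3, ∑ a : Fin k → Fin 3, (∏ i, (![1, 1, 0] : Fin 3 → ℂ) (a i)) *
      kroneckerPow (cwTensor ℂ 2) k a b c =
        ∏ i, (!![0, 1, 0; 1, 1, 0; 0, 0, 1] : Matrix (Fin 3) (Fin 3) ℂ) (b i) (c i) := by
    intro b c
    rw [sliceMatrix_kroneckerPow_prodVec]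
    refine Finset.prod_congr rfl fun i _ => ?_
    have := congrFun (congrFun sliceMatrix_cwTensor_two_eq (b i)) (c i)
    simpa only [Matrix.of_apply] using this
  have hP : (Matrix.of fun (b c : Fin k → Fin 3) => ∑ a, (∏ i, (![1, 1, 0] : Fin 3 → ℂ) (a i)) *
      kroneckerPow (cwTensor ℂ 2) k a b c) =
      Matrix.of fun (b c : Fin k → Fin 3) =>
        ∏ i, (!![0, 1, 0; 1, 1, 0; 0, 0, 1] : Matrix (Fin 3) (Fin 3) ℂ) (b i) (c i) := by
    ext b c
    simp only [Matrix.of_apply, hM]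
  rw [hP]
  intro hdet
  have hprod := congrArg Matrix.det (piMatrix_mul (k := k)
    (!![0, 1, 0; 1, 1, 0; 0, 0, 1] : Matrix (Fin 3) (Fin 3) ℂ) !![-1, 1, 0; 1, 0, 0; 0, 0, 1])
  rw [sliceMatrix_cwTensor_two_mul_inv, piMatrix_one, Matrix.det_mul, Matrix.det_one, hdet,
    zero_mul] at hprod
  exact zero_ne_one hprod

end CwSlice

/-! ## The no-go for odd `k` -/

section NoGo

/-- **No restriction `ε^{⊠k} ≥ T_cw,2^{⊠k}` for odd `k`** (equal format `(Fin k → Fin 3)³`).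
[folklore] -/
theorem not_tensorRestrictsTo_kroneckerPow_leviCivita_cwTensor_two {k : ℕ} (hk : Odd k) :
    ¬ TensorRestrictsTo (kroneckerPow (fun a b c : Fin 3 =>
        (if b = a + 1 ∧ c = a + 2 then (1 : ℂ) else 0) - (if b = a + 2 ∧ c = a + 1 then 1 else 0)) k)
      (kroneckerPow (cwTensor ℂ 2) k) := by
  intro h
  exact det_sliceMatrix_kroneckerPow_cwTensor_two_ne_zero k
    (det_sliceMatrix_eq_zero_of_kroneckerPow_leviCivita_restrictsTo hk h _)

/-- **No degeneration `ε^{⊠k} ⊵ T_cw,2^{⊠k}` for odd `k`** (`T_cw,2^{⊠k}` is not in the orbit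
closure of `ε^{⊠k}` in the format `(Fin k → Fin 3)³`): the equal-format door to `BSkewDominatesCw`
(stmt-18009) through a finite odd Kronecker power is closed, generalising the case `k = 1`
(`not_tensorDegeneratesTo_leviCivita_cwTensor_two`). [cite: ChristandlVranaZuiddam2023, Rem. 1.2] -/
theorem not_tensorDegeneratesTo_kroneckerPow_leviCivita_cwTensor_two {k : ℕ} (hk : Odd k) :
    ¬ TensorDegeneratesTo (kroneckerPow (fun a b c : Fin 3 =>
        (if b = a + 1 ∧ c = a + 2 then (1 : ℂ) else 0) - (if b = a + 2 ∧ c = a + 1 then 1 else 0)) k)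
      (kroneckerPow (cwTensor ℂ 2) k) := by
  intro h
  exact det_sliceMatrix_kroneckerPow_cwTensor_two_ne_zero k
    (det_sliceMatrix_eq_zero_of_kroneckerPow_leviCivita_degeneratesTo hk h _)

end NoGo

end Summit.MatrixMultiplication.MatrixMultiplication.Theorems

end
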